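import Literature.Analysis.Matrix.LogDetMixedDifferenceExpLocalised
import Mathlib.Analysis.Calculus.FDeriv.CompCLM
import Mathlib.Analysis.Calculus.FDeriv.Symmetric
import Mathlib.Analysis.Calculus.Deriv.Comp
import Mathlib.Analysis.Calculus.Deriv.Add
import HarnessLib

/-!
# S6-HESSLOCAL: (OPL) FOR A LOCAL SUM — the Hessian MATRIX of `f = Σ_p f_p`, each `f_p` blind to the coordinates outside `T p`, VANISHES at `(i, j)` unless some `T p ∋ i, j`
# (Combes–Thomas's `hrange`); and a quadratic-form gap `μ‖v‖² ≤ vᵀHv` gives the singular-value FLOOR `μ²‖v‖² ≤ ‖Hv‖²` (Combes–Thomas's `hfloor`)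

Cell `ym3-torus` (YM ladder rung R3 = continuum `SU(2)` Yang–Mills on the three-torus — a RUNG, NOT d = 4, NOT infinite volume, NOT a mass gap, NOT Clay).
Width seat `ym3-torus-px20` (gen 16); `--supports stmt-QuantumFields-20520 --as helper`, count-neutral, definition-free, default heartbeats; registry v11.4 №36
untouched.  BLUEPRINT-ECE₁ S6 needs the DECAY of GREP's covariance `C = H_U⁻¹` (`Σ_{b′} y_{bb′}` small): the tree's Combes–Thomas engine
✓`Literature.Analysis.Matrix.LogDetMixedDifferenceExpLocalised.coercive_combes_thomas_real` turns {finite range `A i j ≠ 0 → dist i j ≤ 1` (hrange), off-diagonal row∕column sums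
`≤ h`, a floor `g²·Σvᵢ² ≤ Σ((A *ᵥ v)ᵢ)²` (hfloor), `h(e^θ − 1) ≤ g∕2`} into `|A⁻¹ i j| ≤ (2∕g)·e^{−θ·dist i j}`.  For the Hessian `H i j = D²f(x)(eᵢ, eⱼ)` of a LOCAL SUM
`f = Σ_{p ∈ S} f_p` (the action in chart coordinates = a sum of plaquette terms, each seeing the coordinates of its own star `T p`) this file supplies the two structural rows:
* §1 `fderiv_apply_single_eq_zero_of_invariant` (a function invariant under the shifts of coordinate `i` has `∂ᵢ = 0`), `fderiv_fderiv_apply_eq_zero_of_fderiv_apply_eq_zero`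
  (`(∀ y, Dg(y) v = 0) ⟹ D²g(x) u v = 0`, Mathlib `fderiv_clm_apply`), ★`hess_single_eq_zero_of_invariant` (`C²` + invariance in coordinate `j` — or, by the symmetry of `D²`, in
  coordinate `i` — kills the `(i, j)` Hessian entry).
* §2 `fderiv_fderiv_sum_apply` (`D²(Σ f_p) = Σ D²f_p`), ★★`hess_sum_eq_zero_of_local` — **(OPL)∕hrange**: `(¬ ∃ p ∈ S, i ∈ T p ∧ j ∈ T p) ⟹ (Matrix.of fun i j => D²f(x)(eᵢ,eⱼ)) i j = 0`,
  and its contrapositive `exists_common_star_of_hess_ne_zero` in `coercive_combes_thomas_real`'s `hrange` shape once `dist i j ≤ 1 ⟸ ∃ p, i, j ∈ T p` (the consumer's metric).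
* §3 ★★`floor_of_quadForm_ge` — **hfloor**: `0 ≤ μ`, `∀ v, μ·Σvᵢ² ≤ v ⬝ᵥ (H *ᵥ v)` ⟹ `∀ v, μ²·Σvᵢ² ≤ Σ((H *ᵥ v)ᵢ)²` (lit ✓`Literature.Analysis.Matrix.sq_floor_of_quadratic_floor` BY NAME
  in the `⬝ᵥ` spelling): the HESS-POS∕GAP♯ letter in the singular-value currency Combes–Thomas reads.
* §4 `hess_sum_symm`, ★★★`abs_inv_hess_le_of_local_gap` — THE CAPSTONE: {local sum, stars of diameter `≤ 1`, off-diagonal row sums `≤ h`, gap `μ > 0`, `h(e^θ − 1) ≤ μ∕2`} ⟹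
  `IsUnit (det H)` and `|H⁻¹ i j| ≤ (2∕μ)·e^{−θ·dist i j}` (lit ✓`coercive_combes_thomas_real` BY NAME; `hcol` from `hrow` by symmetry of `D²`).

HONEST SCOPE.  [folklore] calculus + Cauchy–Schwarz; nothing of the chart's locality rows (which say WHICH coordinates a plaquette term sees), of the gap itself (GAP♯∘∕HESS-POS), of
the row-sum bound `h`, of GREP∕GBND's assembly, of Bałaban's expansions, of GAS∕GAS₁∕REP∕H4ᶜ∕S2β or of `FluctuationComparisonRegPrIntL` (stmt-QuantumFields-20520) is proved; no summit
statement is proved by a helper; rung R3 = SU(2) YM₃ on T³ — NOT d = 4, NOT infinite volume, NOT a mass gap, NOT Clay; the Yang–Mills mass gap is NOT proved.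

References: T. Bałaban, CMP **96** (1984) 223–250 [Balaban1984PropagatorsII] ((1.33), (2.1)–(2.4): gap + random-walk decay); J.-M. Combes, L. Thomas, CMP **34** (1973)
[CombesThomas1973]; T. Bałaban, CMP **102** (1985) 255–275 [Balaban1985UV3] (§B (23)–(30)).
-/

set_option autoImplicit false

noncomputable section

open Finset
open scoped Matrix

namespace Summit.QuantumFields.YangMills.Theorems.LoopLedgerHessLocal

variable {ι : Type*} [Fintype ι] [DecidableEq ι]

/-! ## §1 One coordinate-blind function -/

/-- a function invariant under the shifts of coordinate `i` has vanishing partial derivative `∂ᵢ` (at every point where it is differentiable). [folklore] -/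
theorem fderiv_apply_single_eq_zero_of_invariant {g : (ι → ℝ) → ℝ} {i : ι} (hinv : ∀ (x : ι → ℝ) (t : ℝ), g (x + t • Pi.single i 1) = g x)
    (x : ι → ℝ) (hg : DifferentiableAt ℝ g x) :
    fderiv ℝ g x (Pi.single i 1) = 0 := by
  have hline : HasDerivAt (fun t : ℝ => x + t • (Pi.single i 1 : ι → ℝ)) (Pi.single i 1) 0 := by
    simpa using ((hasDerivAt_id (0 : ℝ)).smul_const (Pi.single i 1 : ι → ℝ)).const_add x
  have hg0 : HasFDerivAt g (fderiv ℝ g x) (x + (0 : ℝ) • (Pi.single i 1 : ι → ℝ)) := by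
    rw [zero_smul, add_zero]
    exact hg.hasFDerivAt
  have hcomp := hg0.comp_hasDerivAt (0 : ℝ) hline
  have hconst : (g ∘ fun t : ℝ => x + t • (Pi.single i 1 : ι → ℝ)) = fun _ => g x := by
    funext t
    exact hinv x t
  rw [hconst] at hcomp
  have h0 := (hasDerivAt_const (0 : ℝ) (g x)).unique hcomp
  exact h0.symm

omit [DecidableEq ι] in
/-- if `Dg(y) v = 0` for every `y`, then `D²g(x) u v = 0` (Mathlib `fderiv_clm_apply`: `D²g(x) u v = D(y ↦ Dg(y) v)(x) u`). [folklore] -/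
theorem fderiv_fderiv_apply_eq_zero_of_fderiv_apply_eq_zero {g : (ι → ℝ) → ℝ} {v : ι → ℝ} (hv : ∀ y, fderiv ℝ g y v = 0) (x u : ι → ℝ)
    (hdg : DifferentiableAt ℝ (fderiv ℝ g) x) :
    fderiv ℝ (fderiv ℝ g) x u v = 0 := by
  have h := fderiv_clm_apply (c := fderiv ℝ g) (u := fun _ => v) hdg (differentiableAt_const v)
  rw [fderiv_const_apply, ContinuousLinearMap.comp_zero, zero_add] at h
  have h2 : fderiv ℝ (fun y => fderiv ℝ g y v) x = 0 := by
    have hc : (fun y => fderiv ℝ g y v) = fun _ => (0 : ℝ) := funext hv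
    rw [hc, fderiv_const_apply]
  have h3 := congrArg (fun L : (ι → ℝ) →L[ℝ] ℝ => L u) h
  simp only [h2, zero_apply, ContinuousLinearMap.flip_apply] at h3
  exact h3.symm

/-- ★ a `C²` function blind to coordinate `j` has `D²g(x)(eᵢ, eⱼ) = 0` AND `D²g(x)(eⱼ, eᵢ) = 0` (the second by the symmetry of second derivatives). [folklore] -/
theorem hess_single_eq_zero_of_invariant {g : (ι → ℝ) → ℝ} (hg : ContDiff ℝ 2 g) {j : ι}
    (hinv : ∀ (x : ι → ℝ) (t : ℝ), g (x + t • Pi.single j 1) = g x) (x : ι → ℝ) (i : ι) :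
    fderiv ℝ (fderiv ℝ g) x (Pi.single i 1) (Pi.single j 1) = 0 ∧ fderiv ℝ (fderiv ℝ g) x (Pi.single j 1) (Pi.single i 1) = 0 := by
  have hdiff : Differentiable ℝ g := hg.differentiable (by norm_num)
  have hdg : DifferentiableAt ℝ (fderiv ℝ g) x := (hg.fderiv_right (m := 1) (by norm_num)).differentiable one_ne_zero x
  have h1 : fderiv ℝ (fderiv ℝ g) x (Pi.single i 1) (Pi.single j 1) = 0 :=
    fderiv_fderiv_apply_eq_zero_of_fderiv_apply_eq_zero (fun y => fderiv_apply_single_eq_zero_of_invariant hinv y (hdiff y)) x _ hdg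
  refine ⟨h1, ?_⟩
  rw [← hg.contDiffAt.isSymmSndFDerivAt (by simp) (Pi.single i 1) (Pi.single j 1)]
  exact h1

/-! ## §2 A local sum -/

omit [DecidableEq ι] in
/-- `D²(Σ_p f_p)(x) = Σ_p D²f_p(x)` for `C²` summands. [folklore] -/
theorem fderiv_fderiv_sum_apply {P : Type*} (S : Finset P) {f : P → (ι → ℝ) → ℝ} (hf : ∀ p ∈ S, ContDiff ℝ 2 (f p)) (x u v : ι → ℝ) :
    fderiv ℝ (fderiv ℝ (fun y => ∑ p ∈ S, f p y)) x u v = ∑ p ∈ S, fderiv ℝ (fderiv ℝ (f p)) x u v := by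
  have h1 : fderiv ℝ (fun y => ∑ p ∈ S, f p y) = fun y => ∑ p ∈ S, fderiv ℝ (f p) y := by
    funext y
    exact fderiv_fun_sum fun p hp => ((hf p hp).differentiable (by norm_num) y)
  rw [h1, fderiv_fun_sum fun p hp => ((hf p hp).fderiv_right (m := 1) (by norm_num)).differentiable one_ne_zero x]
  simp only [FunLike.coe_sum, Finset.sum_apply]

/-- ★★ **(OPL) — THE HESSIAN OF A LOCAL SUM HAS FINITE RANGE.**  If `f = Σ_{p ∈ S} f_p` with every `f_p` of class `C²` and blind to each coordinate outside its star `T p`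
(`j ∉ T p ⟹ f_p (x + t eⱼ) = f_p x`), then the Hessian matrix entry `(i, j)` vanishes unless some star contains both `i` and `j`. [folklore] -/
theorem hess_sum_eq_zero_of_local {P : Type*} (S : Finset P) (T : P → Finset ι) {f : P → (ι → ℝ) → ℝ} (hf : ∀ p ∈ S, ContDiff ℝ 2 (f p))
    (hloc : ∀ p ∈ S, ∀ j, j ∉ T p → ∀ (x : ι → ℝ) (t : ℝ), f p (x + t • Pi.single j 1) = f p x)
    (x : ι → ℝ) {i j : ι} (hij : ¬ ∃ p ∈ S, i ∈ T p ∧ j ∈ T p) :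
    (Matrix.of fun i j => fderiv ℝ (fderiv ℝ (fun y => ∑ p ∈ S, f p y)) x (Pi.single i 1) (Pi.single j 1)) i j = 0 := by
  rw [Matrix.of_apply, fderiv_fderiv_sum_apply S hf]
  refine Finset.sum_eq_zero fun p hp => ?_
  by_cases hi : i ∈ T p
  · have hj : j ∉ T p := fun hj => hij ⟨p, hp, hi, hj⟩
    exact (hess_single_eq_zero_of_invariant (hf p hp) (hloc p hp j hj) x i).1
  · exact (hess_single_eq_zero_of_invariant (hf p hp) (hloc p hp i hi) x j).2

/-- the contrapositive, in Combes–Thomas's `hrange` shape: a non-zero Hessian entry forces a common star (so `dist i j ≤ 1` for any metric in which stars have diameter `≤ 1`).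
[folklore] -/
theorem exists_common_star_of_hess_ne_zero {P : Type*} (S : Finset P) (T : P → Finset ι) {f : P → (ι → ℝ) → ℝ} (hf : ∀ p ∈ S, ContDiff ℝ 2 (f p))
    (hloc : ∀ p ∈ S, ∀ j, j ∉ T p → ∀ (x : ι → ℝ) (t : ℝ), f p (x + t • Pi.single j 1) = f p x)
    (x : ι → ℝ) (i j : ι)
    (hne : (Matrix.of fun i j => fderiv ℝ (fderiv ℝ (fun y => ∑ p ∈ S, f p y)) x (Pi.single i 1) (Pi.single j 1)) i j ≠ 0) :
    ∃ p ∈ S, i ∈ T p ∧ j ∈ T p := by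
  by_contra h
  exact hne (hess_sum_eq_zero_of_local S T hf hloc x h)

/-- the `hrange` row itself, for any `ℕ`-valued metric in which every star has diameter `≤ 1`. [folklore] -/
theorem hrange_of_local {P : Type*} (S : Finset P) (T : P → Finset ι) {f : P → (ι → ℝ) → ℝ} (hf : ∀ p ∈ S, ContDiff ℝ 2 (f p))
    (hloc : ∀ p ∈ S, ∀ j, j ∉ T p → ∀ (x : ι → ℝ) (t : ℝ), f p (x + t • Pi.single j 1) = f p x)
    (dist : ι → ι → ℕ) (hdist : ∀ p ∈ S, ∀ i ∈ T p, ∀ j ∈ T p, dist i j ≤ 1) (x : ι → ℝ) :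
    ∀ i j, (Matrix.of fun i j => fderiv ℝ (fderiv ℝ (fun y => ∑ p ∈ S, f p y)) x (Pi.single i 1) (Pi.single j 1)) i j ≠ 0 → dist i j ≤ 1 := by
  intro i j hne
  obtain ⟨p, hp, hi, hj⟩ := exists_common_star_of_hess_ne_zero S T hf hloc x i j hne
  exact hdist p hp i hi j hj

/-! ## §3 The floor -/

omit [DecidableEq ι] in
/-- ★★ **hfloor from a quadratic-form gap.**  `0 ≤ μ` and `μ·Σvᵢ² ≤ vᵀHv` for all `v` give `μ²·Σvᵢ² ≤ Σ((Hv)ᵢ)²` — the HESS-POS∕GAP♯ letter in the singular-value currency of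
✓`coercive_combes_thomas_real` (`hfloor`, with `g := μ`); for `μ > 0` this is lit ✓`Literature.Analysis.Matrix.sq_floor_of_quadratic_floor` BY NAME (its `Σᵢ vᵢ·(Hv)ᵢ` is
`v ⬝ᵥ (H *ᵥ v)` by `rfl`), `μ = 0` is trivial. [folklore] -/
theorem floor_of_quadForm_ge (H : Matrix ι ι ℝ) {μ : ℝ} (hμ : 0 ≤ μ) (hgap : ∀ v : ι → ℝ, μ * ∑ i, (v i) ^ 2 ≤ v ⬝ᵥ (H *ᵥ v)) (v : ι → ℝ) :
    μ ^ 2 * ∑ i, (v i) ^ 2 ≤ ∑ i, ((H *ᵥ v) i) ^ 2 := by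
  rcases hμ.eq_or_lt with h0 | hpos
  · rw [← h0]
    simpa using Finset.sum_nonneg fun i (_ : i ∈ Finset.univ) => sq_nonneg ((H *ᵥ v) i)
  · exact Literature.Analysis.Matrix.sq_floor_of_quadratic_floor H hpos (fun w => hgap w) v

/-! ## §4 The capstone: exponential decay of `H⁻¹` for the Hessian of a gapped local sum -/

/-- the Hessian matrix of a `C²` local sum is symmetric. [folklore] -/
theorem hess_sum_symm {P : Type*} (S : Finset P) {f : P → (ι → ℝ) → ℝ} (hf : ∀ p ∈ S, ContDiff ℝ 2 (f p)) (x : ι → ℝ) (i j : ι) :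
    (Matrix.of fun i j => fderiv ℝ (fderiv ℝ (fun y => ∑ p ∈ S, f p y)) x (Pi.single i 1) (Pi.single j 1)) i j
      = (Matrix.of fun i j => fderiv ℝ (fderiv ℝ (fun y => ∑ p ∈ S, f p y)) x (Pi.single i 1) (Pi.single j 1)) j i := by
  simp only [Matrix.of_apply]
  have hF : ContDiff ℝ 2 (fun y => ∑ p ∈ S, f p y) := ContDiff.sum fun p hp => hf p hp
  exact hF.contDiffAt.isSymmSndFDerivAt (by simp) _ _

/-- ★★★ **COVARIANCE DECAY FOR THE HESSIAN OF A GAPPED LOCAL SUM (BLUEPRINT S6's `(OPL) + (D1)` at one point, generic).**  `f = Σ_{p∈S} f_p`, each `f_p` of class `C²` and blind to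
the coordinates outside its star `T p`; an `ℕ`-pseudometric `dist` in which stars have diameter `≤ 1`; at the point `x` the Hessian matrix `H i j := D²f(x)(eᵢ,eⱼ)` has off-diagonal
absolute row sums `≤ h`, a gap `μ·Σvᵢ² ≤ vᵀHv` (`μ > 0`), and `h(e^θ − 1) ≤ μ∕2` (`θ ≥ 0`).  THEN `det H` is a unit and `|H⁻¹ i j| ≤ (2∕μ)·e^{−θ·dist i j}` — the tree's
✓`coercive_combes_thomas_real` with `hrange` from §2, `hfloor` from §3 and `hcol` from `hrow` by the symmetry of `H`. [folklore] -/
theorem abs_inv_hess_le_of_local_gap {P : Type*} (S : Finset P) (T : P → Finset ι) {f : P → (ι → ℝ) → ℝ} (hf : ∀ p ∈ S, ContDiff ℝ 2 (f p))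
    (hloc : ∀ p ∈ S, ∀ j, j ∉ T p → ∀ (x : ι → ℝ) (t : ℝ), f p (x + t • Pi.single j 1) = f p x)
    (dist : ι → ι → ℕ) (hd0 : ∀ i, dist i i = 0) (hds : ∀ i j, dist i j = dist j i) (hdt : ∀ i j k, dist i k ≤ dist i j + dist j k)
    (hdist : ∀ p ∈ S, ∀ i ∈ T p, ∀ j ∈ T p, dist i j ≤ 1) (x : ι → ℝ) {h μ θ : ℝ} (hμ : 0 < μ) (hθ : 0 ≤ θ)
    (hrow : ∀ i, ∑ j ∈ Finset.univ.filter (fun j => dist i j ≠ 0),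
      |(Matrix.of fun i j => fderiv ℝ (fderiv ℝ (fun y => ∑ p ∈ S, f p y)) x (Pi.single i 1) (Pi.single j 1)) i j| ≤ h)
    (hgap : ∀ v : ι → ℝ, μ * ∑ i, (v i) ^ 2
      ≤ v ⬝ᵥ ((Matrix.of fun i j => fderiv ℝ (fderiv ℝ (fun y => ∑ p ∈ S, f p y)) x (Pi.single i 1) (Pi.single j 1)) *ᵥ v))
    (hη : h * (Real.exp θ - 1) ≤ μ / 2) :
    IsUnit (Matrix.of fun i j => fderiv ℝ (fderiv ℝ (fun y => ∑ p ∈ S, f p y)) x (Pi.single i 1) (Pi.single j 1)).det ∧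
    ∀ i j, |(Matrix.of fun i j => fderiv ℝ (fderiv ℝ (fun y => ∑ p ∈ S, f p y)) x (Pi.single i 1) (Pi.single j 1))⁻¹ i j|
      ≤ 2 / μ * Real.exp (-(θ * dist i j)) := by
  have hcol : ∀ j, ∑ i ∈ Finset.univ.filter (fun i => dist i j ≠ 0),
      |(Matrix.of fun i j => fderiv ℝ (fderiv ℝ (fun y => ∑ p ∈ S, f p y)) x (Pi.single i 1) (Pi.single j 1)) i j| ≤ h := by
    intro j
    have h1 := hrow j
    have hfilter : Finset.univ.filter (fun i => dist i j ≠ 0) = Finset.univ.filter (fun i => dist j i ≠ 0) := by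
      ext i
      simp [hds i j]
    rw [hfilter]
    refine le_trans (le_of_eq (Finset.sum_congr rfl fun i _ => ?_)) h1
    rw [hess_sum_symm S hf x i j]
  exact Literature.Analysis.Matrix.coercive_combes_thomas_real dist hd0 hds hdt _ (hrange_of_local S T hf hloc dist hdist x) h hrow hcol μ θ hμ hθ
    (floor_of_quadForm_ge _ hμ.le hgap) hη

/-! ## §5 (appended, v1.2) The row sums from per-term bounds and a star count — Combes–Thomas's `hrow`

`abs_hess_le_of_local`, `sum_card_filter_eq`, ★★`hrow_of_local`: per-term Hessian bounds `|D²f_p(x)(eᵢ,eⱼ)| ≤ M₂` and a star count `Σ_{p ∋ i} #(T p) ≤ N` give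
`Σ_{j : dist i j ≠ 0} |H i j| ≤ N·M₂` — with §2 (`hrange`), §3 (`hfloor`) and `hess_sum_symm` (`hcol`) the complete input set of ✓`coercive_combes_thomas_real` ∕ §4's capstone, so
that the model owes exactly {stars `T p`, `M₂`, `N`, the gap `μ`}. -/

/-- one Hessian entry of a local sum: only the stars containing BOTH `i` and `j` contribute, each at most `M₂`. [folklore] -/
theorem abs_hess_le_of_local {P : Type*} (S : Finset P) (T : P → Finset ι) {f : P → (ι → ℝ) → ℝ} (hf : ∀ p ∈ S, ContDiff ℝ 2 (f p))
    (hloc : ∀ p ∈ S, ∀ j, j ∉ T p → ∀ (x : ι → ℝ) (t : ℝ), f p (x + t • Pi.single j 1) = f p x)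
    (x : ι → ℝ) {M₂ : ℝ}
    (hM : ∀ p ∈ S, ∀ i j, |fderiv ℝ (fderiv ℝ (f p)) x (Pi.single i 1) (Pi.single j 1)| ≤ M₂) (i j : ι) :
    |(Matrix.of fun i j => fderiv ℝ (fderiv ℝ (fun y => ∑ p ∈ S, f p y)) x (Pi.single i 1) (Pi.single j 1)) i j|
      ≤ M₂ * ((S.filter fun p => i ∈ T p ∧ j ∈ T p).card : ℝ) := by
  classical
  rw [Matrix.of_apply, fderiv_fderiv_sum_apply S hf]
  have hsplit : ∑ p ∈ S, fderiv ℝ (fderiv ℝ (f p)) x (Pi.single i 1) (Pi.single j 1)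
      = ∑ p ∈ S.filter (fun p => i ∈ T p ∧ j ∈ T p), fderiv ℝ (fderiv ℝ (f p)) x (Pi.single i 1) (Pi.single j 1) := by
    rw [← Finset.sum_filter_add_sum_filter_not S (fun p => i ∈ T p ∧ j ∈ T p)]
    have hz : ∑ p ∈ S.filter (fun p => ¬ (i ∈ T p ∧ j ∈ T p)), fderiv ℝ (fderiv ℝ (f p)) x (Pi.single i 1) (Pi.single j 1) = 0 := by
      refine Finset.sum_eq_zero fun p hp => ?_
      rw [Finset.mem_filter] at hp
      obtain ⟨hpS, hnot⟩ := hp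
      by_cases hi : i ∈ T p
      · have hj : j ∉ T p := fun hj => hnot ⟨hi, hj⟩
        exact (hess_single_eq_zero_of_invariant (hf p hpS) (hloc p hpS j hj) x i).1
      · exact (hess_single_eq_zero_of_invariant (hf p hpS) (hloc p hpS i hi) x j).2
    rw [hz, add_zero]
  rw [hsplit]
  refine (Finset.abs_sum_le_sum_abs _ _).trans ?_
  calc ∑ p ∈ S.filter (fun p => i ∈ T p ∧ j ∈ T p), |fderiv ℝ (fderiv ℝ (f p)) x (Pi.single i 1) (Pi.single j 1)|
      ≤ ∑ p ∈ S.filter (fun p => i ∈ T p ∧ j ∈ T p), M₂ :=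
        Finset.sum_le_sum fun p hp => hM p (Finset.mem_filter.1 hp).1 i j
    _ = M₂ * ((S.filter fun p => i ∈ T p ∧ j ∈ T p).card : ℝ) := by
        rw [Finset.sum_const, nsmul_eq_mul, mul_comm]

/-- the star count: `Σ_j #{p ∈ S : i, j ∈ T p} = Σ_{p ∈ S, i ∈ T p} #(T p)` (double counting). [folklore] -/
theorem sum_card_filter_eq {P : Type*} (S : Finset P) (T : P → Finset ι) (i : ι) :
    ∑ j : ι, ((S.filter fun p => i ∈ T p ∧ j ∈ T p).card : ℝ) = ∑ p ∈ S.filter (fun p => i ∈ T p), ((T p).card : ℝ) := by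
  classical
  have h1 : ∀ j : ι, ((S.filter fun p => i ∈ T p ∧ j ∈ T p).card : ℝ) = ∑ p ∈ S, (if i ∈ T p ∧ j ∈ T p then (1 : ℝ) else 0) := by
    intro j
    rw [← Finset.sum_boole]
  simp_rw [h1]
  rw [Finset.sum_comm, Finset.sum_filter]
  refine Finset.sum_congr rfl fun p _ => ?_
  by_cases hi : i ∈ T p
  · simp only [hi, true_and, if_true]
    rw [Finset.sum_boole]
    congr 2
    ext j
    simp
  · simp [hi]

/-- ★★ **hrow from locality**: per-term Hessian bounds `|D²f_p(x)(eᵢ,eⱼ)| ≤ M₂` and a star count `Σ_{p ∋ i} #(T p) ≤ N` give the off-diagonal absolute row sums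
`Σ_{j : dist i j ≠ 0} |H i j| ≤ N·M₂` — Combes–Thomas's `hrow` (and `hcol`, by `hess_sum_symm`). [folklore] -/
theorem hrow_of_local {P : Type*} (S : Finset P) (T : P → Finset ι) {f : P → (ι → ℝ) → ℝ} (hf : ∀ p ∈ S, ContDiff ℝ 2 (f p))
    (hloc : ∀ p ∈ S, ∀ j, j ∉ T p → ∀ (x : ι → ℝ) (t : ℝ), f p (x + t • Pi.single j 1) = f p x)
    (x : ι → ℝ) {M₂ : ℝ} (hM0 : 0 ≤ M₂)
    (hM : ∀ p ∈ S, ∀ i j, |fderiv ℝ (fderiv ℝ (f p)) x (Pi.single i 1) (Pi.single j 1)| ≤ M₂)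
    {N : ℝ} (hN : ∀ i, ∑ p ∈ S.filter (fun p => i ∈ T p), ((T p).card : ℝ) ≤ N) (dist : ι → ι → ℕ) (i : ι) :
    ∑ j ∈ Finset.univ.filter (fun j => dist i j ≠ 0),
        |(Matrix.of fun i j => fderiv ℝ (fderiv ℝ (fun y => ∑ p ∈ S, f p y)) x (Pi.single i 1) (Pi.single j 1)) i j| ≤ N * M₂ := by
  classical
  calc ∑ j ∈ Finset.univ.filter (fun j => dist i j ≠ 0),
          |(Matrix.of fun i j => fderiv ℝ (fderiv ℝ (fun y => ∑ p ∈ S, f p y)) x (Pi.single i 1) (Pi.single j 1)) i j|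
      ≤ ∑ j : ι, |(Matrix.of fun i j => fderiv ℝ (fderiv ℝ (fun y => ∑ p ∈ S, f p y)) x (Pi.single i 1) (Pi.single j 1)) i j| :=
        Finset.sum_le_sum_of_subset_of_nonneg (Finset.filter_subset _ _) fun j _ _ => abs_nonneg _
    _ ≤ ∑ j : ι, M₂ * ((S.filter fun p => i ∈ T p ∧ j ∈ T p).card : ℝ) :=
        Finset.sum_le_sum fun j _ => abs_hess_le_of_local S T hf hloc x hM i j
    _ = M₂ * ∑ p ∈ S.filter (fun p => i ∈ T p), ((T p).card : ℝ) := by rw [← Finset.mul_sum, sum_card_filter_eq]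
    _ ≤ M₂ * N := mul_le_mul_of_nonneg_left (hN i) hM0
    _ = N * M₂ := mul_comm _ _

end Summit.QuantumFields.YangMills.Theorems.LoopLedgerHessLocal

end
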